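import Literature.NumberTheory.Automorphic.UnitaryGroupLineTorusPushTwo
import HarnessLib

/-!
# The unipotent (line) term of `U(J₂)`, torus stage ⇒ idelic stage — GUARDED normal form (`T > 0` only)
(Rogawski, *Automorphic Representations of Unitary Groups in Three Variables* (1990), Prop. 7.3.1 (p. 97), §7.2 Prop. 7.2.2 (pp. 94–95).)

Topic `NumberTheory/Automorphic`; namespace `Literature.NumberTheory.Automorphic.UnitaryGroup`. THEOREMS ONLY (no definition,
no named fact, no instance, no notation, no `sorry`). Companion of ★ `UnitaryGroupLineTorusPushTwo` ED. 2 (cell `pub/hodgecm-mathlib`,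
crux H413, H-side (σ-u) row): the constants-first heads `exists_pushConst_forall_lineTorusStage_eq[_linear]_two` RE-PROVED with the
normal-form hypothesis GUARDED to `T > 0`,

  `hΘ : ∀ T, 0 < T → ∀ t, δ_B(t)⁻¹ • Θ T t = V₀ · G_T((N_{E∕F}(d₀ t))⁻¹)`,

because for the ACTUAL torus integrand `Θ_T(t) = ∫_{K_U} ψ_T(t k) dμ_K` of the line bracket the identity is available only for
`T > 0` (at `T = 0` the truncation tail is the full constant term while the cut-off indicator `{‖y‖ < (0∕H₁)⁻¹}` is empty —
F0P3a-p04 (g7)'s remark); the conclusions were `∀ T > 0` already, so nothing else changes (the proofs use `hΘ T hT t`).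

* `exists_pushConst_forall_lineTorusStage_eq_two'` — torus stage ⇒ idelic stage with integrability, ONE constant `C` first;
* **`exists_pushConst_forall_lineTorusStage_eq_linear_two'`** — `= V₀·C·(½[V log(T∕H₁)·c𝔉f(0) + A + cÂ − V f(0)] + ½[A_ω + cÂ_ω])`.

HC_CM is proved only modulo the printed citations until rung 0 closes — nothing here bears on a summit statement.

## References

* J. D. Rogawski, *Automorphic Representations of Unitary Groups in Three Variables*, Ann. of Math. Stud. 123 (1990), Prop. 7.3.1
  (p. 97), §7.2 Prop. 7.2.2 (pp. 94–95) [Rogawski1990].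
* G. B. Folland, *A Course in Abstract Harmonic Analysis* (1995), §2.6 Thm. 2.49 [Folland1995].
* J. Tate, *Fourier analysis in number fields and Hecke's zeta-functions* (1967), Ch. XV Thm. 4.4.1 [CasselsFrohlichANT1967].
-/

set_option autoImplicit false

noncomputable section

open MeasureTheory MeasureTheory.Measure NumberField IsDedekindDomain Set Filter Literature.MeasureTheory.Group
open scoped ENNReal NNReal
open Literature.NumberTheory.Automorphic.Meyer
open Literature.NumberTheory.QuadraticForms (normIdeles)
open Literature.NumberTheory.GaloisRepresentations (measurableSet_principalIdeles_sup_normIdeles quadraticArtinIndicator)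

namespace Literature.NumberTheory.Automorphic

namespace UnitaryGroup

/-! ## §1 Set bookkeeping -/

section Idelic

variable (K : Type) [Field K] [NumberField K]

/-- `(𝓕 ∩ H)⁻¹ = 𝓕⁻¹ ∩ H` for a subgroup `H` of the idele group. [folklore] -/
private theorem inv_inter_coe_subgroup_eq₃ (𝓕 : Set (GaloisRepresentations.ideleGroup K))
    (H : Subgroup (GaloisRepresentations.ideleGroup K)) :
    (𝓕 ∩ (H : Set (GaloisRepresentations.ideleGroup K)))⁻¹ = 𝓕⁻¹ ∩ (H : Set (GaloisRepresentations.ideleGroup K)) := by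
  ext x
  simp only [Set.mem_inv, Set.mem_inter_iff, SetLike.mem_coe, inv_mem_iff]

end Idelic

/-! ## §2 The push of the GUARDED normal form, constants first -/

section Push

variable {F E : Type} [Field F] [NumberField F] [Field E] [NumberField E] [Algebra F E]
  [Algebra.IsQuadraticExtension F E] {c : E ≃ₐ[F] E}
  [MeasurableSpace (quasiSplit F E c 2).Adelic] [BorelSpace (quasiSplit F E c 2).Adelic]
  [MeasurableSpace (AdeleRing (𝓞 F) F)] [BorelSpace (AdeleRing (𝓞 F) F)]
  [MeasurableSpace (GaloisRepresentations.ideleGroup F)] [BorelSpace (GaloisRepresentations.ideleGroup F)]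

/-! ## §3 Uniform editions: the push constant before the data -/
/-- **THE PUSH CONSTANT FIRST** (uniform edition of `lineTorusStage_eq_mul_setIntegral_tateIntegrand_two`): the constant `C` of
★ (C-P) `exists_push_and_integral_comp_ideleRelNorm_diagUnitZero_eq` depends only on `(δ, θ₀, μ_T, ν_F)`; it is produced BEFORE
the idele class domain, the torus weight `w_T`, the Schwartz–Bruhat function `f`, `H₁`, `V₀`, the normal-form integrand `Θ` and `T`
are chosen — so one constant serves every unipotent class of `U(J₂)` at once. [cite: Rogawski1990, §7.2 Prop. 7.2.2 (p. 94)] -/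
theorem exists_pushConst_forall_lineTorusStage_eq_two' (hc : c * c = 1)
    {δ : E} (hcδ : c δ = -δ) (hδ : δ ≠ 0) (θ₀ : 𝓞 F) (hθ : θ₀ ≠ 0) (hd : δ * δ = algebraMap F E (θ₀ : F))
    (μT : Measure (torusInBorel F E c 2)) [IsHaarMeasure μT]
    (μA : Measure (AdeleRing (𝓞 F) F)) [μA.IsAddHaarMeasure]
    (νF : Measure (GaloisRepresentations.ideleGroup F)) [νF.IsHaarMeasure] :
    ∃ C : ℝ≥0∞, C ≠ 0 ∧ C ≠ ∞ ∧ ∀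
    {𝓕F : Set (GaloisRepresentations.ideleGroup F)} (h𝓕 : IsIdeleClassDomain F 𝓕F)
    {wT : torusInBorel F E c 2 → ℝ≥0∞}
    (hwT : IsCoveringWeight ((rationalBorel F E c 2).subgroupOf (torusInBorel F E c 2)) wT)
    {f : AdeleRing (𝓞 F) F → ℂ} (hf : f ∈ schwartzBruhatAdele F) {H₁ : ℝ} (hH₁ : 0 < H₁) (V₀ : ℝ)
    {Θ : ℝ≥0 → torusInBorel F E c 2 → ℂ}
    (hΘ : ∀ (T : ℝ≥0), 0 < (T : ℝ) → ∀ (t : torusInBorel F E c 2),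
      ((torusRootModulus E 2 (diagUnit (t : borelAdelic F E c 2).2) : ℝ≥0) : ℝ)⁻¹ • Θ T t =
        (V₀ : ℂ) *
          ((ideleSum F f (AdeleRing.ideleRelNorm F E (diagUnit (t : borelAdelic F E c 2).2 0))⁻¹ -
              ((IdeleClassGroup.ideleNorm F (AdeleRing.ideleRelNorm F E (diagUnit (t : borelAdelic F E c 2).2 0))⁻¹ : ℝ) : ℂ)⁻¹ *
                {y : GaloisRepresentations.ideleGroup F |
                    (IdeleClassGroup.ideleNorm F y : ℝ) < ((T : ℝ) / H₁)⁻¹}.indicator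
                  (fun _ => ((μA (adeleFundamentalDomain F)).toReal⁻¹ : ℂ) * adeleFourier F μA f 0)
                  (AdeleRing.ideleRelNorm F E (diagUnit (t : borelAdelic F E c 2).2 0))⁻¹) *
            ((IdeleClassGroup.ideleNorm F (AdeleRing.ideleRelNorm F E (diagUnit (t : borelAdelic F E c 2).2 0))⁻¹ : ℝ) : ℂ)))
    (T : ℝ≥0), 0 < (T : ℝ) →
      Integrable (fun t : torusInBorel F E c 2 =>
        ((wT t).toReal * ((torusRootModulus E 2 (diagUnit (t : borelAdelic F E c 2).2) : ℝ≥0) : ℝ)⁻¹) • Θ T t) μT ∧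
      ∫ t, ((wT t).toReal * ((torusRootModulus E 2 (diagUnit (t : borelAdelic F E c 2).2) : ℝ≥0) : ℝ)⁻¹) • Θ T t ∂μT =
        ((V₀ : ℂ) * (C.toReal : ℂ)) *
          ∫ x in 𝓕F ∩ ↑(GaloisRepresentations.principalIdeles F ⊔ normIdeles F (θ₀ : F)),
            (ideleSum F f x - ((IdeleClassGroup.ideleNorm F x : ℝ) : ℂ)⁻¹ *
              {y : GaloisRepresentations.ideleGroup F |
                  (IdeleClassGroup.ideleNorm F y : ℝ) < ((T : ℝ) / H₁)⁻¹}.indicator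
                (fun _ => ((μA (adeleFundamentalDomain F)).toReal⁻¹ : ℂ) * adeleFourier F μA f 0) x) *
            ((IdeleClassGroup.ideleNorm F x : ℝ) : ℂ) ∂νF := by
  haveI := locallyCompactSpace_ideleGroup F
  haveI := secondCountableTopology_ideleGroup F
  haveI := t2Space_ideleGroup F
  -- the push constant of (C-P)
  obtain ⟨C, hC0, hCt, -, hpush⟩ :=
    exists_push_and_integral_comp_ideleRelNorm_diagUnitZero_eq_two hc hcδ hδ θ₀ hθ hd μT νF
  refine ⟨C, hC0, hCt, ?_⟩
  intro 𝓕F h𝓕 wT hwT f hf H₁ hH₁ V₀ Θ hΘ T hT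
  have hR : 0 < (T : ℝ) / H₁ := div_pos hT hH₁
  -- Tate's integrand at the cut-off `(T/H₁)⁻¹`, read at `y⁻¹`
  set G : GaloisRepresentations.ideleGroup F → ℂ := fun x =>
    (ideleSum F f x⁻¹ - ((IdeleClassGroup.ideleNorm F x⁻¹ : ℝ) : ℂ)⁻¹ *
        {y : GaloisRepresentations.ideleGroup F | (IdeleClassGroup.ideleNorm F y : ℝ) < ((T : ℝ) / H₁)⁻¹}.indicator
          (fun _ => ((μA (adeleFundamentalDomain F)).toReal⁻¹ : ℂ) * adeleFourier F μA f 0) x⁻¹) *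
      ((IdeleClassGroup.ideleNorm F x⁻¹ : ℝ) : ℂ) with hGdef
  have hGm : Measurable G := measurable_tateIntegrand_comp_inv F hf _ _
  have hGinv : ∀ k ∈ GaloisRepresentations.principalIdeles F, ∀ x, G (k * x) = G x :=
    fun k hk x => tateIntegrand_comp_inv_principal_mul F f _ _ hk x
  -- finiteness on the idelic side, at the idele class domain `𝓕F⁻¹`
  set Hs : Set (GaloisRepresentations.ideleGroup F) :=
    ↑(GaloisRepresentations.principalIdeles F ⊔ normIdeles F (θ₀ : F)) with hHs
  have hGint : IntegrableOn G (𝓕F⁻¹ ∩ Hs) νF :=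
    integrableOn_tateIntegrand_comp_inv_inter F μA νF h𝓕 hf hR Hs
  have hfin : ∫⁻ y in 𝓕F⁻¹ ∩ Hs, ‖G y‖ₑ ∂νF < ∞ := hGint.2
  obtain ⟨hI, -, hEq⟩ := hpush wT hwT 𝓕F⁻¹ h𝓕.inv G hGm hGinv hfin
  -- the torus integrand in terms of `G`
  have hΘ' : ∀ t : torusInBorel F E c 2,
      ((wT t).toReal * ((torusRootModulus E 2 (diagUnit (t : borelAdelic F E c 2).2) : ℝ≥0) : ℝ)⁻¹) • Θ T t =
        (V₀ : ℂ) * ((wT t).toReal • G (AdeleRing.ideleRelNorm F E (diagUnit (t : borelAdelic F E c 2).2 0))) := by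
    intro t
    rw [mul_smul, hΘ T hT t, hGdef, Complex.real_smul, Complex.real_smul]
    ring
  refine ⟨?_, ?_⟩
  · have h := hI.const_mul (V₀ : ℂ)
    refine h.congr (ae_of_all _ fun t => ?_)
    simp only []
    rw [hΘ' t]
  -- assemble: pull the constant, push, invert
  calc ∫ t, ((wT t).toReal * ((torusRootModulus E 2 (diagUnit (t : borelAdelic F E c 2).2) : ℝ≥0) : ℝ)⁻¹) • Θ T t ∂μT
      = ∫ t, (V₀ : ℂ) * ((wT t).toReal • G (AdeleRing.ideleRelNorm F E (diagUnit (t : borelAdelic F E c 2).2 0))) ∂μT :=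
        integral_congr_ae (ae_of_all _ fun t => hΘ' t)
    _ = (V₀ : ℂ) * ((C.toReal : ℂ) * ∫ x in 𝓕F⁻¹ ∩ Hs, G x ∂νF) := by
        rw [integral_const_mul, hEq]
    _ = ((V₀ : ℂ) * (C.toReal : ℂ)) * ∫ x in 𝓕F ∩ Hs, G x⁻¹ ∂νF := by
        rw [hHs, ← inv_inter_coe_subgroup_eq₃ F 𝓕F,
          setIntegral_inv_eq_setIntegral_comp_inv F νF (h𝓕.measurableSet.inter
            (measurableSet_principalIdeles_sup_normIdeles (θ₀ : F))) G, mul_assoc]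
    _ = _ := by
        simp only [hGdef, inv_inv]


/-- **UNIPOTENT (LINE) TERM OF `U(J₂)`, TORUS STAGE ⇒ `𝔄 · log(T∕H₁) + 𝔅`, WITH THE PUSH CONSTANT FIRST** (uniform edition of
`lineTorusStage_eq_linear_two`): ONE `C ∈ (0, ∞)` such that for every idele class domain, torus weight, `f ∈ 𝒮(𝔸_F)`, `H₁ > 0`, `V₀`,
normal-form `Θ` and `T > 0` the torus stage equals `V₀·C·(½[V log(T∕H₁)·c𝔉f(0) + A + cÂ − V f(0)] + ½[A_ω + cÂ_ω])`.
[cite: Rogawski1990, §7.2 Prop. 7.2.2 (pp. 94–95)] -/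
theorem exists_pushConst_forall_lineTorusStage_eq_linear_two' (hc : c * c = 1)
    {δ : E} (hcδ : c δ = -δ) (hδ : δ ≠ 0) (θ₀ : 𝓞 F) (hθ : θ₀ ≠ 0) (hd : δ * δ = algebraMap F E (θ₀ : F))
    (hsq : ¬ IsSquare ((θ₀ : 𝓞 F) : F))
    (μT : Measure (torusInBorel F E c 2)) [IsHaarMeasure μT]
    (μA : Measure (AdeleRing (𝓞 F) F)) [μA.IsAddHaarMeasure]
    (νF : Measure (GaloisRepresentations.ideleGroup F)) [νF.IsHaarMeasure] :
    ∃ C : ℝ≥0∞, C ≠ 0 ∧ C ≠ ∞ ∧ ∀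
    {𝓕F : Set (GaloisRepresentations.ideleGroup F)} (h𝓕 : IsIdeleClassDomain F 𝓕F)
    {wT : torusInBorel F E c 2 → ℝ≥0∞}
    (hwT : IsCoveringWeight ((rationalBorel F E c 2).subgroupOf (torusInBorel F E c 2)) wT)
    {f : AdeleRing (𝓞 F) F → ℂ} (hf : f ∈ schwartzBruhatAdele F) {H₁ : ℝ} (hH₁ : 0 < H₁) (V₀ : ℝ)
    {Θ : ℝ≥0 → torusInBorel F E c 2 → ℂ}
    (hΘ : ∀ (T : ℝ≥0), 0 < (T : ℝ) → ∀ (t : torusInBorel F E c 2),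
      ((torusRootModulus E 2 (diagUnit (t : borelAdelic F E c 2).2) : ℝ≥0) : ℝ)⁻¹ • Θ T t =
        (V₀ : ℂ) *
          ((ideleSum F f (AdeleRing.ideleRelNorm F E (diagUnit (t : borelAdelic F E c 2).2 0))⁻¹ -
              ((IdeleClassGroup.ideleNorm F (AdeleRing.ideleRelNorm F E (diagUnit (t : borelAdelic F E c 2).2 0))⁻¹ : ℝ) : ℂ)⁻¹ *
                {y : GaloisRepresentations.ideleGroup F |
                    (IdeleClassGroup.ideleNorm F y : ℝ) < ((T : ℝ) / H₁)⁻¹}.indicator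
                  (fun _ => ((μA (adeleFundamentalDomain F)).toReal⁻¹ : ℂ) * adeleFourier F μA f 0)
                  (AdeleRing.ideleRelNorm F E (diagUnit (t : borelAdelic F E c 2).2 0))⁻¹) *
            ((IdeleClassGroup.ideleNorm F (AdeleRing.ideleRelNorm F E (diagUnit (t : borelAdelic F E c 2).2 0))⁻¹ : ℝ) : ℂ)))
    (T : ℝ≥0), 0 < (T : ℝ) →
      ∫ t, ((wT t).toReal * ((torusRootModulus E 2 (diagUnit (t : borelAdelic F E c 2).2) : ℝ≥0) : ℝ)⁻¹) • Θ T t ∂μT =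
        ((V₀ : ℂ) * (C.toReal : ℂ)) *
          ((1 / 2 : ℂ) * ((((idelicCovolume F νF).toReal * Real.log ((T : ℝ) / H₁) : ℝ) : ℂ) *
                (((μA (adeleFundamentalDomain F)).toReal⁻¹ : ℂ) * adeleFourier F μA f 0) +
              ((∫ x in {x | 1 ≤ (IdeleClassGroup.ideleNorm F x : ℝ)} ∩ 𝓕F,
                  ideleSum F f x * ((IdeleClassGroup.ideleNorm F x : ℝ) : ℂ) ∂νF) +
                ((μA (adeleFundamentalDomain F)).toReal⁻¹ : ℂ) *
                  (∫ x in {x | 1 ≤ (IdeleClassGroup.ideleNorm F x : ℝ)} ∩ 𝓕F,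
                    ideleSum F (adeleFourier F μA f) x ∂νF) -
                ((idelicCovolume F νF).toReal : ℂ) * f 0)) +
            (1 / 2 : ℂ) * ((∫ x in {x | 1 ≤ (IdeleClassGroup.ideleNorm F x : ℝ)} ∩ 𝓕F,
                ideleSum F f x * (-1 : ℂ) ^ (GaloisRepresentations.quadraticArtinIndicator F ((θ₀ : 𝓞 F) : F) x).val *
                  ((IdeleClassGroup.ideleNorm F x : ℝ) : ℂ) ∂νF) +
              ((μA (adeleFundamentalDomain F)).toReal⁻¹ : ℂ) *
                ∫ x in {x | 1 ≤ (IdeleClassGroup.ideleNorm F x : ℝ)} ∩ 𝓕F,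
                  ideleSum F (adeleFourier F μA f) x *
                    (-1 : ℂ) ^ (GaloisRepresentations.quadraticArtinIndicator F ((θ₀ : 𝓞 F) : F) x⁻¹).val ∂νF)) := by
  obtain ⟨C, hC0, hCt, h⟩ := exists_pushConst_forall_lineTorusStage_eq_two' hc hcδ hδ θ₀ hθ hd μT μA νF
  refine ⟨C, hC0, hCt, ?_⟩
  intro 𝓕F h𝓕 wT hwT f hf H₁ hH₁ V₀ Θ hΘ T hT
  rw [(h h𝓕 hwT hf hH₁ V₀ hΘ T hT).2,
    (integrableOn_and_setIntegral_tateTruncated_inter_normClasses_haar μA νF hsq h𝓕 hf (div_pos hT hH₁)).2]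

end Push

end UnitaryGroup

end Literature.NumberTheory.Automorphic
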